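import Summits.BirchSwinnertonDyer.BirchSwinnertonDyer.Theorems.KatoDescentPotSupersingularReducibleHullDescentCount
import HarnessLib

/-!
# THE `λ`-EXACT `J`-ROAD FOR CRUX M (item 19196), SEQUEL: the Poitou–Tate ledger + exact fine control + (b′) on the rows
# `W(ℚ_p)[p] = 0` — `ord_p #Ш(W)[p^∞] + v_p(Tam W) + v_p(λ(0)) ≤ e + v_p(c_p) + 2·v_p #W(ℚ)_tors`, and in 27962's normal form of
# (b′) `ord_p #Ш(W)[p^∞] + v_p(Tam W) ≤ ord_p(L(W,1)/Ω(W)) + t_p + 2·v_p #W(ℚ)_tors` — modulo {H2X, FW, Lim 3.5}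

Seat `bsd-potss-rkm` g29 (prover, cell `bsd-potss`), item stmt-BirchSwinnertonDyer-19196 `ReducibleKatoMember` = crux M of
K9 `KatoDescentPotSupersingular` (support) / K8-t′ `KatoDescentTamePotSupersingular` (auto-crux); `--supports … --as helper`;
route-free; closes nothing.  HONEST FRAMING: BSD is proved for no curve by this file; nothing is booked; crux M stays cite-level
on {modularity, HELD 27962 `Kato2004.exists_memberHullZetaCoreInputs`}; theorems only.

The prequel `…ReducibleHullDescentCount` proves, for ANY class `y ∈ 𝐇¹_Γ(T_pW)` with `y₀` of infinite order and Kato's hull data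
`(F, j, z, λ)` (`j y = λ·z`, Thm. 12.5 (3) for the normalised `z` read against the constructed `X₀` off `(p)`) and a descent package
`J ⊇ X₀` (H2X): `v_p(λ(0)) + ord_p #Sel₀(ℚ_∞,W[p^∞])^Γ ≤ ord_p [H¹(ℤ[1/p],T_pW) : ℤ_p·y₀]` on a reducible row.  THIS FILE feeds it
into the KERNEL Poitou–Tate ledger of parts 39–58 (`tamagawa_mul_sha_mul_index_le_ppart_of_zetaLineOrthIndexAt`, PT over `ℚ` a
tree theorem) and the KERNEL exact fine control `#(X₀)_Γ = #Sel_str(ℚ, W[p^∞])` on the rows with `W(ℚ_p)[p] = 0` (seat g27):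

* §3 **`padicValNat_sha_add_tamagawa_add_valuation_le_of_zetaLineOrthIndexAt_of_hull`**: for every `e` with (b′)
  `ZetaLineOrthIndexAt W p (layerZeroToTop y₀) e`, **`ord_p #Ш(W)[p^∞] + v_p(Tam W) + v_p(λ(0)) ≤ e + v_p(c_p) + 2·v_p #W(ℚ)_tors`**
  (cf. seat g28's `λ`-lossy `… ≤ e + v_p(c_p) + 2·v_p #tors` for the `(c,d)`-zeta lift); `…_normalForm_of_hull`: with 27962's printed
  exponent `e = ord_p q + v_p(λ(0)) + t_p − v_p(c_p)` (`L(W,1)/Ω(W) = q`): **`ord_p #Ш(W)[p^∞] + v_p(Tam W) ≤ ord_p q + t_p + 2·v_p #W(ℚ)_tors`**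
  — crux M's inequality AT `W` (slack `2`, M allows `3`; `t_p = ord_p #W(ℚ_p)[p^∞] = 0` on these rows, kept symbolic).
* §4 rows `…_of_addv_of_eleven_le` (EVERY additive `p ≥ 11` = all (t′) rows of K8-t′), `…_of_addv` (`p ∈ {5,7}` off Kodaira II/III).

READING.  On the tame reducible rows the honest minimal HELD input for crux M is therefore the HULL SUB-PACKAGE of 27962 —
{member `W_K`, `ZetaBody` family + lift `𝐲`, `F, j, z, λ, j𝐲 = λz, z ≠ 0, F/Λz` torsion, finite coker, `λ(0) ≠ 0`, Thm. 12.5 (3)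
against `X₀`, (b′) in normal form} — with the seven abstract-`𝐇²` fields of 27962 replaced by {H2X, FW, Lim 3.5} and kernel theorems;
NOT the clause «(b′) with `e ≤ ord q + ord #tors − v(c_p)`» (which would assert the unprinted `v_p(λ(0)) ≤ ord_p #W_K(ℚ)_tors`).

References: K. Kato, Astérisque 295 (2004), Thm. 12.5 (1)–(3) and 12.6 (pp. 221–222), Lemma 13.10 (1) (p. 230), 13.12–13.14
(pp. 231–234), Thm. 14.5 (p. 236), (14.9.3) (p. 240), §14.14 (pp. 243–244), Prop. 14.16 (2) (pp. 244–245), Lemma 14.18 (pp. 247–248)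
[Kato2004Asterisque]; C.-H. Kim, AJM 148 §3.2.3 [Kim2022StructureSelmer]; J. S. Milne, *ADT* I Cor. 2.3, Thm. 4.10 (b)
[MilneADT2006]; R. Greenberg, LNM 1716 §3 Prop. 3.8, §4 Lemma 4.2 [GreenbergLNM1716]; B. Mazur, Publ. IHÉS 47 (1977) III.§5 [Mazur1977].
-/

-- the summit and its single problem are both named `BirchSwinnertonDyer` (registry layout D-0017)
set_option linter.dupNamespace false
set_option autoImplicit false

noncomputable section

open scoped Classical NumberField TensorProduct
open Function Field NumberField IsDedekindDomain WeierstrassCurve CongruenceSubgroup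
open Literature.NumberTheory.EllipticCurves Literature.NumberTheory.EllipticCurves.GreenbergSelmer
open Literature.NumberTheory.GaloisRepresentations
open Literature.NumberTheory.EllipticCurves.ModularForms
open Literature.NumberTheory.EllipticCurves.Kato2004 Literature.NumberTheory.EllipticCurves.Kato2004.EulerSystemValues
open Literature.NumberTheory.EllipticCurves.IwasawaAlgebra Literature.NumberTheory.EllipticCurves.IwasawaDual
open Literature.NumberTheory.GaloisRepresentations.DiscreteGaloisModule Literature.NumberTheory.GaloisCohomology
open Literature.NumberTheory.EllipticCurves.Rank1Residual
open Summit.BirchSwinnertonDyer.Rank1Residual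
open Summit.BirchSwinnertonDyer.Rank1Residual.X11b.Levels Summit.BirchSwinnertonDyer.Rank1Residual.X11b.LocBridge
  Summit.BirchSwinnertonDyer.Rank1Residual.X11b.AcSelmer
open Summit.BirchSwinnertonDyer.BirchSwinnertonDyer.Theorems
open Summit.BirchSwinnertonDyer.BirchSwinnertonDyer.Theorems.ASideJunction
open Summit.BirchSwinnertonDyer.BirchSwinnertonDyer.Theorems.KatoFiniteLevelCount
open Summit.BirchSwinnertonDyer.BirchSwinnertonDyer.Theorems.StrictSelmerBridge
open Summit.BirchSwinnertonDyer.BirchSwinnertonDyer.Theorems.IntegralH1LayerZeroTop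

universe u

namespace Summit.BirchSwinnertonDyer.BirchSwinnertonDyer.Theorems.ReducibleHullDescentCount

/-! ## §3 The bound on the rows with `W(ℚ_p)[p] = 0`: Poitou–Tate ledger + exact control + (b′) -/

section Bound

variable (W : WeierstrassCurve ℚ) [W.IsElliptic] (p : ℕ) [Fact p.Prime]
  [ContinuousSMul ℤ_[p] (W.tateModule p)]
  [Finite W.toAffine.Point] [Finite (AddCommGroup.primaryComponent W.sha p)]
  {κ : ZpExtension ℚ p} {γ : absoluteGaloisGroup ℚ}

/-- **CRUX M's INEQUALITY, `λ`-EXACT, MODULO (b′), on a reducible row with `W(ℚ_p)[p] = 0`.**  `W/ℚ` elliptic, `p ≠ 2`, `W[p]`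
reducible, `W(ℚ)` and `Ш(W)[p^∞]` finite, `W(ℚ_p)[p] = 0`, `(κ,γ)` cyclotomic, `I` the pin; `y ∈ 𝐇¹_Γ(T_pW)` ANY class with `y₀` of
infinite order and hull data `(F, j, z, λ)` as in §2 (`j y = λ·z`, Thm. 12.5 (3) for `z` against `X₀` off `(p)`).  Then for every `e`
with (b′) `ZetaLineOrthIndexAt W p (layerZeroToTop y₀) e`:
**`ord_p #Ш(W)[p^∞] + v_p(Tam W) + v_p(λ(0)) ≤ e + v_p(c_p) + 2·v_p #W(ℚ)_tors`** — modulo the named facts {H2X, FW, Lim 3.5} in the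
binders and nothing else (Poitou–Tate over `ℚ`, the ledger of parts 39–58, the exact fine control and `W(ℚ_{p,∞})[p^∞] = 0` being
kernel theorems).  PROOF: the ledger `p^{v Tam}·#Ш[p^∞]·[A : ℤ_p y₀] ≤ p^{v c_p}·#Sel_str·p^e·(p^{v #tors})²`
(`tamagawa_mul_sha_mul_index_le_ppart_of_zetaLineOrthIndexAt`), `#Sel_str = #(X₀)_Γ = #Sel₀(ℚ_∞)^Γ` (exact control), and §2
`p^{v(λ(0))}·#Sel₀(ℚ_∞)^Γ ≤ [A : ℤ_p y₀]` (all `p`-powers).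
[cite: Kato2004Asterisque, Thm. 12.5 (3) (p. 222), Lemma 13.10 (1) (p. 230), Thm. 14.5 (3) (p. 236), (14.9.3) (p. 240), §14.14 (pp. 243–244), Prop. 14.16 (2) (pp. 244–245), Lemma 14.18 (pp. 247–248)]
[cite: MilneADT2006, Ch. I, Cor. 2.3, Thm. 4.10 (b)] [cite: GreenbergLNM1716, §3 Prop. 3.8, §4 Lemma 4.2] -/
theorem padicValNat_sha_add_tamagawa_add_valuation_le_of_zetaLineOrthIndexAt_of_hull
    (hX : exists_iwasawaH2Data_fineSelmerDual_embedding)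
    (hLim : Lim2017.thm35_fineSelmerDual_moduleFinite_of_classicalMuVanishes_of_le_divisionField)
    (hFW : Literature.NumberTheory.IwasawaTheory.ferreroWashington1979_classicalMuVanishes)
    (hp : p ≠ 2) (hκ : κ.IsCyclotomic) (hγ : κ.IsTopGenerator γ) (hred : ¬ W.HasIrreducibleModPGaloisRep p)
    (h4 : ∀ R : (W.baseChange ℚ_[p]).toAffine.Point, p • R = 0 → R = 0)
    (I : IwasawaH1Data W p κ γ)
    {F : Type} [AddCommGroup F] [Module (IwasawaAlgebra p) F] [Module.Finite (IwasawaAlgebra p) F]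
    [NoZeroSMulDivisors (IwasawaAlgebra p) F]
    (j : I.H →ₗ[IwasawaAlgebra p] F) (hj : Function.Injective j) (hcok : Finite (F ⧸ LinearMap.range j))
    (z : F) (hz : z ≠ 0) (hFZ : Module.IsTorsion (IwasawaAlgebra p) (F ⧸ (IwasawaAlgebra p) ∙ z))
    (hdiv : ∀ 𝔮 : PrimeSpectrum (IwasawaAlgebra p), 𝔮.asIdeal.height = 1 → 𝔮.asIdeal ≠ augIdealP p →
      Module.lengthAt (IwasawaAlgebra p) (W.fineSelmerDualData κ hγ).X 𝔮 ≤
        Module.lengthAt (IwasawaAlgebra p) (F ⧸ (IwasawaAlgebra p) ∙ z) 𝔮)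
    (y : I.H) (lam : IwasawaAlgebra p) (hlam : PowerSeries.constantCoeff lam ≠ 0) (hjy : j y = lam • z)
    (hnt : ¬ IsOfFinAddOrder (I.proj 0 y))
    (e : ℕ) (hb : ZetaLineOrthIndexAt W p (layerZeroToTop W p κ (I.proj 0 y)) e) :
    padicValNat p (Nat.card (AddCommGroup.primaryComponent W.sha p)) + padicValNat p W.tamagawaProduct +
        (PowerSeries.constantCoeff lam).valuation ≤
      e + padicValNat p ((W.baseChange ((primePlace p).adicCompletion ℚ)).localTamagawaNumber
          ((primePlace p).adicCompletionIntegers ℚ)) + 2 * padicValNat p W.torsionOrder := by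
  have hpp : p.Prime := Fact.out
  have hPT : poitouTate_selmerStructure_duality ℚ :=
    poitouTate_selmerStructure_duality_of_conj (InputsPoitouTateSelmer.poitouTate_selmerStructure_duality_conj_holds ℚ)
  -- Kato's `𝐇² ⊇ X₀` package (H2X; its finiteness hypothesis from `W(ℚ_p)[p] = 0`)
  obtain ⟨J, eX, heX, hcokX⟩ := hX W p κ γ hγ (primePlace p) hp hκ (coe_primesEquiv_primePlace p)
    (TowerTorsionVanishing.finite_fixedPoints_kerSubgroup_inf_decomp_of_noPTorsionPadic W p κ (primePlace p)
      (coe_primesEquiv_primePlace p) h4) I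
  -- §2: the `λ`-exact count
  obtain ⟨hfinSel, hfinIdx, hcount⟩ := valuation_add_padicValNat_fineSelmer_invariants_le_index_of_hull W p hLim hFW hp hκ hγ hred
    I J eX heX hcokX j hj hcok z hz hFZ hdiv y lam hlam hjy hnt
  haveI := hfinSel
  haveI := hfinIdx
  -- exact control: `#(X₀)_Γ = #Sel_str`, hence `#Sel₀(ℚ_∞)^Γ = #Sel_str`
  have hctrl : Nat.card (endInvariants (W.conjFineSelmerInfty κ γ - 1)) = Nat.card (katoStrictSelmer W p {primePlace p}) := by
    rw [← ((W.fineSelmerDualData κ hγ).isDualPair hγ).natCard_coinvariants]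
    exact ExactFineControl.natCard_coinvariants_fineSelmerDual_eq_natCard_katoStrictSelmer W κ hp hκ hγ h4 _
  -- the zeta line at `⊤` and the index in the ledger currency
  set y₀ : H1 (tateRep W p) ⊤ := layerZeroToTop W p κ (I.proj 0 y) with hy₀def
  have hy₀ : y₀ ∈ integralH1 (tateRep W p) p ⊤ := layerZeroToTop_mem_integralH1 W p κ (I.proj_mem 0 y)
  have hrel := ReducibleTameShaBound.natCard_quotient_span_layerZero_eq_relIndex_top I y
  have hidx0 : Nat.card (integralH1 (tateRep W p) p (κ.layerSubgroup 0) ⧸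
      Submodule.span ℤ_[p] {(⟨I.proj 0 y, I.proj_mem 0 y⟩ : integralH1 (tateRep W p) p (κ.layerSubgroup 0))}) ≠ 0 :=
    Nat.card_pos.ne'
  have hrel0 : (ℤ_[p] ∙ y₀).toAddSubgroup.relIndex (integralH1 (tateRep W p) p ⊤).toAddSubgroup ≠ 0 := hrel ▸ hidx0
  obtain ⟨N, hN⟩ := exists_pow_smul_mem_span_singleton_of_relIndex_ne_zero (integralH1 (tateRep W p) p ⊤) y₀ hy₀ hrel0
  -- the strict-unramified and relaxed-unramified structures, the finite set of bad places
  obtain ⟨𝓢inf, hSp, hSur, hSinl⟩ : ∃ 𝓢 : SelmerStructure (primaryGaloisModule W p),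
      𝓢 (Sum.inr (primePlace p)) = ⊥ ∧
      (∀ v : HeightOneSpectrum (𝓞 ℚ), v ≠ primePlace p →
        𝓢 (Sum.inr v) = unramifiedSubgroup (GaloisRep.toLocal v (primaryGaloisModule W p)) 1) ∧
      ∀ w : InfinitePlace ℚ, 𝓢 (Sum.inl w) = ⊤ :=
    ⟨fun v => match v with
      | Sum.inl _ => ⊤
      | Sum.inr v => if v = primePlace p then ⊥ else unramifiedSubgroup (GaloisRep.toLocal v (primaryGaloisModule W p)) 1,
     if_pos rfl, fun v hv => if_neg hv, fun _ => rfl⟩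
  obtain ⟨𝓤inf, hUp, hUur, hUinl⟩ : ∃ 𝓤 : SelmerStructure (primaryGaloisModule W p),
      𝓤 (Sum.inr (primePlace p)) = ⊤ ∧
      (∀ v : HeightOneSpectrum (𝓞 ℚ), v ≠ primePlace p →
        𝓤 (Sum.inr v) = unramifiedSubgroup (GaloisRep.toLocal v (primaryGaloisModule W p)) 1) ∧
      ∀ w : InfinitePlace ℚ, 𝓤 (Sum.inl w) = ⊤ :=
    ⟨fun v => match v with
      | Sum.inl _ => ⊤
      | Sum.inr v => if v = primePlace p then ⊤ else unramifiedSubgroup (GaloisRep.toLocal v (primaryGaloisModule W p)) 1,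
     if_pos rfl, fun v hv => if_neg hv, fun _ => rfl⟩
  obtain ⟨S, hS⟩ : ∃ S : Finset (HeightOneSpectrum (𝓞 ℚ)), ∀ v, v ∉ S → W.HasGoodReductionAt v := by
    have h := WeierstrassCurve.eventually_hasGoodReductionAt W
    rw [Filter.eventually_cofinite] at h
    exact ⟨h.toFinset, fun v hv => by_contra fun hbad => hv (h.mem_toFinset.mpr hbad)⟩
  -- part 58: the level-0 count in naturals; part 59: the strict group in the Literature currency
  have h58 := tamagawa_mul_sha_mul_index_le_ppart_of_zetaLineOrthIndexAt W p 𝓤inf 𝓢inf hPT hp (insert (primePlace p) S)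
    (Finset.mem_insert_self _ _) (fun v hv => hS v fun h => hv (Finset.mem_insert_of_mem h)) hUp hUur hUinl hSp hSur hSinl y₀ hy₀ N hN e hb
  have h59 : Nat.card 𝓢inf.selmerGroup = Nat.card (katoStrictSelmer W p {primePlace p}) :=
    natCard_selmerGroup_eq_natCard_katoStrictSelmer W p 𝓢inf hSp hSur hSinl
  rw [h59, ← hctrl, ← hrel] at h58
  -- every factor is a power of `p`: `[A : y₀] = p^m`, `#Sel₀^Γ = p^k`, `#Ш[p^∞] = p^s`, with `v(λ(0)) + k ≤ m`
  set idx := Nat.card (integralH1 (tateRep W p) p (κ.layerSubgroup 0) ⧸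
      Submodule.span ℤ_[p] {(⟨I.proj 0 y, I.proj_mem 0 y⟩ : integralH1 (tateRep W p) p (κ.layerSubgroup 0))}) with hidx
  set cS := Nat.card (endInvariants (W.conjFineSelmerInfty κ γ - 1)) with hcS
  have hcS0 : cS ≠ 0 := Nat.card_pos.ne'
  obtain ⟨m, hm⟩ : ∃ m : ℕ, idx = p ^ m := ⟨padicValNat p idx, by
    obtain ⟨m, hm⟩ := MemberHullZetaInputsOfCore.natCard_eq_prime_pow_of_finite_module p ℤ_[p]
      (integralH1 (tateRep W p) p (κ.layerSubgroup 0) ⧸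
        Submodule.span ℤ_[p] {(⟨I.proj 0 y, I.proj_mem 0 y⟩ : integralH1 (tateRep W p) p (κ.layerSubgroup 0))})
    rw [hidx, hm, padicValNat.prime_pow]⟩
  obtain ⟨s, hs⟩ := MemberHullZetaInputsOfCore.natCard_primaryComponent_eq_prime_pow p (G := ↥W.sha)
  -- from §2: `v(λ(0)) + v cS ≤ m`
  have hcount' : (PowerSeries.constantCoeff lam).valuation + padicValNat p cS ≤ m := by
    have : padicValNat p idx = m := by rw [hm, padicValNat.prime_pow]
    omega
  -- the ledger: `p^{v Tam} · p^s · idx ≤ p^{v c_p} · cS · p^e · (p^{v tors})²`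
  set a := p ^ padicValNat p W.tamagawaProduct * Nat.card (AddCommGroup.primaryComponent (↥W.sha) p) with ha
  set b := p ^ padicValNat p ((W.baseChange ((primePlace p).adicCompletion ℚ)).localTamagawaNumber
      ((primePlace p).adicCompletionIntegers ℚ)) * p ^ e * (p ^ padicValNat p W.torsionOrder) ^ 2 with hb'
  have h1 : a * idx ≤ b * cS := by
    calc a * idx = p ^ padicValNat p W.tamagawaProduct * Nat.card (AddCommGroup.primaryComponent (↥W.sha) p) * idx := by rw [ha]
      _ ≤ _ := h58
      _ = b * cS := by rw [hb']; ring
  -- `cS` is a power of `p` (a finite `Λ`-coinvariant quotient counted through the dual pair): `cS = p^{v cS}`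
  obtain ⟨k, hkS⟩ : ∃ k : ℕ, cS = p ^ k := by
    haveI : Finite (coinvariants p (W.fineSelmerDualData κ hγ).X) :=
      ((W.fineSelmerDualData κ hγ).isDualPair hγ).finite_coinvariants_iff.mpr hfinSel
    obtain ⟨k, hk'⟩ := MemberHullZetaInputsOfCore.natCard_eq_prime_pow_of_finite_module p (IwasawaAlgebra p)
      (coinvariants p (W.fineSelmerDualData κ hγ).X)
    exact ⟨k, by rw [hcS, ← ((W.fineSelmerDualData κ hγ).isDualPair hγ).natCard_coinvariants]; exact hk'⟩
  have hkv : padicValNat p cS = k := by rw [hkS, padicValNat.prime_pow]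
  -- `a · p^{v λ(0)} · cS ≤ a · idx ≤ b · cS`, cancel `cS`
  have h2 : a * (p ^ ((PowerSeries.constantCoeff lam).valuation) * cS) ≤ b * cS := by
    have hle : p ^ ((PowerSeries.constantCoeff lam).valuation) * cS ≤ idx := by
      rw [hkS, ← pow_add, hm]
      exact Nat.pow_le_pow_right hpp.pos (by omega)
    calc a * (p ^ ((PowerSeries.constantCoeff lam).valuation) * cS) ≤ a * idx := Nat.mul_le_mul_left a hle
      _ ≤ b * cS := h1
  have h3 : a * p ^ ((PowerSeries.constantCoeff lam).valuation) ≤ b := by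
    rw [← mul_assoc] at h2
    exact Nat.le_of_mul_le_mul_right h2 (Nat.pos_of_ne_zero hcS0)
  have h4' : p ^ (padicValNat p W.tamagawaProduct + s + (PowerSeries.constantCoeff lam).valuation) ≤
      p ^ (e + padicValNat p ((W.baseChange ((primePlace p).adicCompletion ℚ)).localTamagawaNumber
          ((primePlace p).adicCompletionIntegers ℚ)) + 2 * padicValNat p W.torsionOrder) := by
    calc p ^ (padicValNat p W.tamagawaProduct + s + (PowerSeries.constantCoeff lam).valuation)
        = a * p ^ ((PowerSeries.constantCoeff lam).valuation) := by rw [ha, hs, pow_add, pow_add]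
      _ ≤ b := h3
      _ = _ := by rw [hb', ← pow_mul, ← pow_add, ← pow_add]; ring_nf
  have h5 := (Nat.pow_le_pow_iff_right hpp.one_lt).mp h4'
  rw [hs, padicValNat.prime_pow]
  omega

/-- **NORMAL FORM of clause (b′) ⟹ crux M's inequality AT `W` with slack `2·ord_p #tors` (+ `t_p`).**  Same data; if the
exponent of (b′) has 27962's printed normal form `e = ord_p q + v_p(λ(0)) + t_p − v_p(c_p)` (`L(W,1)/Ω(W) = q`,
`t_p = ord_p #W(ℚ_p)[p^∞]`; Prop. 14.16 (2) `ν` / Lemma 14.18 with Kim §3.2.3 and Thm. 12.5 (1), Lemma 13.10 (1)), then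
**`ord_p #Ш(W)[p^∞] + v_p(Tam W) ≤ ord_p q + t_p + 2·v_p #W(ℚ)_tors`** — the multiplier `λ(0)` and the local Tamagawa factor
CANCEL.  (On these rows `t_p = 0`, `W(ℚ_p)[p] = 0`; kept symbolic.)  Modulo {H2X, FW, Lim 3.5}.
[cite: Kato2004Asterisque, Thm. 12.5 (1) (p. 221), Lemma 13.10 (1) (p. 230), Prop. 14.16 (2) (pp. 244–245), Lemma 14.18 (pp. 247–248)]
[cite: Kim2022StructureSelmer, §3.2.3 display before Thm. 3.7 (PDF p. 16)] -/
theorem padicValNat_sha_add_tamagawa_le_of_zetaLineOrthIndexAt_normalForm_of_hull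
    (hX : exists_iwasawaH2Data_fineSelmerDual_embedding)
    (hLim : Lim2017.thm35_fineSelmerDual_moduleFinite_of_classicalMuVanishes_of_le_divisionField)
    (hFW : Literature.NumberTheory.IwasawaTheory.ferreroWashington1979_classicalMuVanishes)
    (hp : p ≠ 2) (hκ : κ.IsCyclotomic) (hγ : κ.IsTopGenerator γ) (hred : ¬ W.HasIrreducibleModPGaloisRep p)
    (h4 : ∀ R : (W.baseChange ℚ_[p]).toAffine.Point, p • R = 0 → R = 0)
    (I : IwasawaH1Data W p κ γ)
    {F : Type} [AddCommGroup F] [Module (IwasawaAlgebra p) F] [Module.Finite (IwasawaAlgebra p) F]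
    [NoZeroSMulDivisors (IwasawaAlgebra p) F]
    (j : I.H →ₗ[IwasawaAlgebra p] F) (hj : Function.Injective j) (hcok : Finite (F ⧸ LinearMap.range j))
    (z : F) (hz : z ≠ 0) (hFZ : Module.IsTorsion (IwasawaAlgebra p) (F ⧸ (IwasawaAlgebra p) ∙ z))
    (hdiv : ∀ 𝔮 : PrimeSpectrum (IwasawaAlgebra p), 𝔮.asIdeal.height = 1 → 𝔮.asIdeal ≠ augIdealP p →
      Module.lengthAt (IwasawaAlgebra p) (W.fineSelmerDualData κ hγ).X 𝔮 ≤
        Module.lengthAt (IwasawaAlgebra p) (F ⧸ (IwasawaAlgebra p) ∙ z) 𝔮)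
    (y : I.H) (lam : IwasawaAlgebra p) (hlam : PowerSeries.constantCoeff lam ≠ 0) (hjy : j y = lam • z)
    (hnt : ¬ IsOfFinAddOrder (I.proj 0 y)) {q : ℚ} {e : ℕ}
    (he : (e : ℤ) = padicValRat p q + ((PowerSeries.constantCoeff lam).valuation : ℤ) +
        (padicValNat p (Nat.card (AddCommGroup.primaryComponent
          (W.baseChange ((primePlace p).adicCompletion ℚ)).toAffine.Point p)) : ℤ) -
        (padicValNat p ((W.baseChange ((primePlace p).adicCompletion ℚ)).localTamagawaNumber
          ((primePlace p).adicCompletionIntegers ℚ)) : ℤ))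
    (hb : ZetaLineOrthIndexAt W p (layerZeroToTop W p κ (I.proj 0 y)) e) :
    (padicValNat p (Nat.card (AddCommGroup.primaryComponent W.sha p)) : ℤ) + padicValNat p W.tamagawaProduct ≤
      padicValRat p q + padicValNat p (Nat.card (AddCommGroup.primaryComponent
          (W.baseChange ((primePlace p).adicCompletion ℚ)).toAffine.Point p)) + 2 * (padicValNat p W.torsionOrder : ℤ) := by
  have h := padicValNat_sha_add_tamagawa_add_valuation_le_of_zetaLineOrthIndexAt_of_hull W p hX hLim hFW hp hκ hγ hred h4 I j hj
    hcok z hz hFZ hdiv y lam hlam hjy hnt e hb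
  have h' : ((padicValNat p (Nat.card (AddCommGroup.primaryComponent W.sha p)) : ℕ) : ℤ) +
      (padicValNat p W.tamagawaProduct : ℤ) + ((PowerSeries.constantCoeff lam).valuation : ℤ) ≤
      (e : ℤ) + (padicValNat p ((W.baseChange ((primePlace p).adicCompletion ℚ)).localTamagawaNumber
          ((primePlace p).adicCompletionIntegers ℚ)) : ℤ) + 2 * (padicValNat p W.torsionOrder : ℤ) := by
    exact_mod_cast h
  linarith

end Bound

/-! ## §4 Rows: every additive `p ≥ 11`; additive `p ∈ {5, 7}` off Kodaira II/III -/

section Rows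

variable (W : WeierstrassCurve ℚ) [W.IsElliptic] [W.IsGloballyMinimal] (p : ℕ) [Fact p.Prime]
  [ContinuousSMul ℤ_[p] (W.tateModule p)]
  [Finite W.toAffine.Point] [Finite (AddCommGroup.primaryComponent W.sha p)]
  {κ : ZpExtension ℚ p} {γ : absoluteGaloisGroup ℚ}

/-- **On EVERY additive row at `p ≥ 11`** (all (t′) rows of K8-t′; `W(ℚ_p)[p] = 0` there, Mazur's step):
`ord_p #Ш(W)[p^∞] + v_p(Tam W) + v_p(λ(0)) ≤ e + v_p(c_p) + 2·v_p #W(ℚ)_tors` for every `e` with (b′), any class with hull data.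
[cite: Kato2004Asterisque, Thm. 12.5 (3) (p. 222), Thm. 14.5 (3) (p. 236), Prop. 14.16 (2) (pp. 244–245)] [cite: Mazur1977, Ch. III §5, Step 1 (p. 158)] -/
theorem padicValNat_sha_add_tamagawa_add_valuation_le_of_zetaLineOrthIndexAt_of_hull_of_addv_of_eleven_le
    (hX : exists_iwasawaH2Data_fineSelmerDual_embedding)
    (hLim : Lim2017.thm35_fineSelmerDual_moduleFinite_of_classicalMuVanishes_of_le_divisionField)
    (hFW : Literature.NumberTheory.IwasawaTheory.ferreroWashington1979_classicalMuVanishes)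
    (h11 : 11 ≤ p) (hadd : Addv W p) (hκ : κ.IsCyclotomic) (hγ : κ.IsTopGenerator γ) (hred : ¬ W.HasIrreducibleModPGaloisRep p)
    (I : IwasawaH1Data W p κ γ)
    {F : Type} [AddCommGroup F] [Module (IwasawaAlgebra p) F] [Module.Finite (IwasawaAlgebra p) F]
    [NoZeroSMulDivisors (IwasawaAlgebra p) F]
    (j : I.H →ₗ[IwasawaAlgebra p] F) (hj : Function.Injective j) (hcok : Finite (F ⧸ LinearMap.range j))
    (z : F) (hz : z ≠ 0) (hFZ : Module.IsTorsion (IwasawaAlgebra p) (F ⧸ (IwasawaAlgebra p) ∙ z))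
    (hdiv : ∀ 𝔮 : PrimeSpectrum (IwasawaAlgebra p), 𝔮.asIdeal.height = 1 → 𝔮.asIdeal ≠ augIdealP p →
      Module.lengthAt (IwasawaAlgebra p) (W.fineSelmerDualData κ hγ).X 𝔮 ≤
        Module.lengthAt (IwasawaAlgebra p) (F ⧸ (IwasawaAlgebra p) ∙ z) 𝔮)
    (y : I.H) (lam : IwasawaAlgebra p) (hlam : PowerSeries.constantCoeff lam ≠ 0) (hjy : j y = lam • z)
    (hnt : ¬ IsOfFinAddOrder (I.proj 0 y))
    (e : ℕ) (hb : ZetaLineOrthIndexAt W p (layerZeroToTop W p κ (I.proj 0 y)) e) :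
    padicValNat p (Nat.card (AddCommGroup.primaryComponent W.sha p)) + padicValNat p W.tamagawaProduct +
        (PowerSeries.constantCoeff lam).valuation ≤
      e + padicValNat p ((W.baseChange ((primePlace p).adicCompletion ℚ)).localTamagawaNumber
          ((primePlace p).adicCompletionIntegers ℚ)) + 2 * padicValNat p W.torsionOrder :=
  padicValNat_sha_add_tamagawa_add_valuation_le_of_zetaLineOrthIndexAt_of_hull W p hX hLim hFW (by omega) hκ hγ hred
    (fun _ hR ↦ Additive.eq_zero_of_prime_nsmul_eq_zero_of_addv_of_eleven_le W p h11 hadd hR) I j hj hcok z hz hFZ hdiv y lam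
    hlam hjy hnt e hb

/-- **On an additive row at `p ≥ 5` off Kodaira II/III** (`p = 5 ⟹ v₅(c₄) ≠ 1`, `p = 7 ⟹ v₇(c₆) ≠ 1`).
[cite: Kato2004Asterisque, Thm. 12.5 (3) (p. 222), Thm. 14.5 (3) (p. 236), Prop. 14.16 (2) (pp. 244–245)] [cite: Mazur1977, Ch. III §5, Step 1 (p. 158)] -/
theorem padicValNat_sha_add_tamagawa_add_valuation_le_of_zetaLineOrthIndexAt_of_hull_of_addv
    (hX : exists_iwasawaH2Data_fineSelmerDual_embedding)
    (hLim : Lim2017.thm35_fineSelmerDual_moduleFinite_of_classicalMuVanishes_of_le_divisionField)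
    (hFW : Literature.NumberTheory.IwasawaTheory.ferreroWashington1979_classicalMuVanishes)
    (hp5 : 5 ≤ p) (hadd : Addv W p) (h5 : p = 5 → padicValRat p W.c₄ ≠ 1) (h7 : p = 7 → padicValRat p W.c₆ ≠ 1)
    (hκ : κ.IsCyclotomic) (hγ : κ.IsTopGenerator γ) (hred : ¬ W.HasIrreducibleModPGaloisRep p)
    (I : IwasawaH1Data W p κ γ)
    {F : Type} [AddCommGroup F] [Module (IwasawaAlgebra p) F] [Module.Finite (IwasawaAlgebra p) F]
    [NoZeroSMulDivisors (IwasawaAlgebra p) F]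
    (j : I.H →ₗ[IwasawaAlgebra p] F) (hj : Function.Injective j) (hcok : Finite (F ⧸ LinearMap.range j))
    (z : F) (hz : z ≠ 0) (hFZ : Module.IsTorsion (IwasawaAlgebra p) (F ⧸ (IwasawaAlgebra p) ∙ z))
    (hdiv : ∀ 𝔮 : PrimeSpectrum (IwasawaAlgebra p), 𝔮.asIdeal.height = 1 → 𝔮.asIdeal ≠ augIdealP p →
      Module.lengthAt (IwasawaAlgebra p) (W.fineSelmerDualData κ hγ).X 𝔮 ≤
        Module.lengthAt (IwasawaAlgebra p) (F ⧸ (IwasawaAlgebra p) ∙ z) 𝔮)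
    (y : I.H) (lam : IwasawaAlgebra p) (hlam : PowerSeries.constantCoeff lam ≠ 0) (hjy : j y = lam • z)
    (hnt : ¬ IsOfFinAddOrder (I.proj 0 y))
    (e : ℕ) (hb : ZetaLineOrthIndexAt W p (layerZeroToTop W p κ (I.proj 0 y)) e) :
    padicValNat p (Nat.card (AddCommGroup.primaryComponent W.sha p)) + padicValNat p W.tamagawaProduct +
        (PowerSeries.constantCoeff lam).valuation ≤
      e + padicValNat p ((W.baseChange ((primePlace p).adicCompletion ℚ)).localTamagawaNumber
          ((primePlace p).adicCompletionIntegers ℚ)) + 2 * padicValNat p W.torsionOrder :=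
  padicValNat_sha_add_tamagawa_add_valuation_le_of_zetaLineOrthIndexAt_of_hull W p hX hLim hFW (by omega) hκ hγ hred
    (fun _ hR ↦ Additive.eq_zero_of_prime_nsmul_eq_zero_of_addv W p hp5 hadd h5 h7 hR) I j hj hcok z hz hFZ hdiv y lam hlam hjy
    hnt e hb

end Rows

/-! ## §5 On the Λ-adic lift of a value-guarded `ZetaBody` family (the binders under which 27962 speaks of `𝐲`, `F`, `z`, `λ`) -/

section ZetaLift

variable (W : WeierstrassCurve ℚ) [W.IsElliptic] (p : ℕ) [Fact p.Prime]
  [ContinuousSMul ℤ_[p] (W.tateModule p)] [Module.Free ℤ_[p] (W.tateModule p)]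
  [Module.Finite ℤ_[p] (W.tateModule p)]
  [Finite W.toAffine.Point] [Finite (AddCommGroup.primaryComponent W.sha p)]
  {κ : ZpExtension ℚ p} {γ : absoluteGaloisGroup ℚ}

/-- **THE CARVED PACKAGE IN ACTION: crux M's inequality modulo (b′) for the `(c,d,a(A))`-ZETA LIFT `𝐲` with its hull data.**
For a value-guarded `ZetaBody` family of the newform `f` of a curve `V` with `L(V,1) ≠ 0` and ITS Λ-adic lift `𝐲 ∈ 𝐇¹_Γ(T_pW)`
(`∀ n, proj n 𝐲 = levelToLayer … (z (n+1) …)`; `𝐲₀` has infinite order from the VALUE, `MemberIndexOfValue.not_isOfFinAddOrder_proj_zero_of_zetaBody`),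
the hull data `(F, j, zF, λ)` of 27962 (`j 𝐲 = λ·zF`, Thm. 12.5 (3) for `zF` against `X₀` off `(p)`), on a row with `W[p]` reducible and
`W(ℚ_p)[p] = 0`: for every `e` with (b′) `ZetaLineOrthIndexAt W p (layerZeroToTop 𝐲₀) e`,
**`ord_p #Ш(W)[p^∞] + v_p(Tam W) + v_p(λ(0)) ≤ e + v_p(c_p) + 2·v_p #W(ℚ)_tors`** — modulo {H2X, FW, Lim 3.5}.  These binders ARE the
fields of the hull sub-package of `Kato2004.MemberHullZetaCoreInputs` (`F, j, finite_coker, z, z_ne_zero, isTorsion_quotient, lam, j_y,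
lam_constantCoeff_ne_zero`, `divisibility_offP` read against `X₀`, `zetaLineIndex`).
[cite: Kato2004Asterisque, Thm. 12.5 (1)–(3) and 12.6 (pp. 221–222), Lemma 13.10 (1) (p. 230), 13.14 (p. 234), Prop. 14.16 (2) (pp. 244–245), Lemma 14.18 (pp. 247–248)]
[cite: Kim2022StructureSelmer, §3.2.3 display before Thm. 3.7 (PDF p. 16)] -/
theorem padicValNat_sha_add_tamagawa_add_valuation_le_of_zetaLineOrthIndexAt_zetaLift_of_hull
    (hX : exists_iwasawaH2Data_fineSelmerDual_embedding)
    (hLim : Lim2017.thm35_fineSelmerDual_moduleFinite_of_classicalMuVanishes_of_le_divisionField)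
    (hFW : Literature.NumberTheory.IwasawaTheory.ferreroWashington1979_classicalMuVanishes)
    (hp : p ≠ 2) (hκ : κ.IsCyclotomic) (hγ : κ.IsTopGenerator γ) (hred : ¬ W.HasIrreducibleModPGaloisRep p)
    (h4 : ∀ R : (W.baseChange ℚ_[p]).toAffine.Point, p • R = 0 → R = 0)
    (I : IwasawaH1Data W p κ γ) {N : ℕ} [NeZero N] {f : CuspForm (Gamma0 N) 2}
    {ι : (m : ℕ) → (CyclotomicField m ℚ →+* ℂ)} {κ' : ℝ}
    {Λ' : ∀ (k : ℕ) (r : Finset (HeightOneSpectrum (𝓞 ℚ))),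
      H1 (tateRep W p) (cycSubgroup p k r) →ₗ[ℤ_[p]] ℚ_[p] ⊗[ℚ] CyclotomicField (cycLevel p k r) ℚ}
    {c d a : ℤ} {A : ℕ}
    {z : ∀ (k : ℕ) (r : (cyclotomicLevelsRat p (badPlaces c d A N)).Ideals),
      H1 (tateRep W p) ((cyclotomicLevelsRat p (badPlaces c d A N)).level k r.1)}
    {x : ∀ (k : ℕ) (r : (cyclotomicLevelsRat p (badPlaces c d A N)).Ideals),
      CyclotomicField (cycLevel p k r.1) ℚ}
    (hbody : ZetaBody W p f ι κ' Λ' c d a A z x)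
    {y : I.H} (hy : ∀ n : ℕ, I.proj n y = levelToLayer W p hκ hp (badPlaces c d A N) n
      (z (n + 1) (cyclotomicLevelsRat p (badPlaces c d A N)).idealOne))
    {V : WeierstrassCurve ℚ} [V.IsElliptic] (hf : IsNewformOf V f) (hL1 : V.entireLFunction 1 ≠ 0)
    (hκ' : κ' ≠ 0) (hA : 0 < A) (d' : ℤ) (hcd : Int.gcd (c * d) A = 1) (hdd' : d * d' ≡ 1 [ZMOD (A : ℤ)])
    (hR : cuspFactor f true (fun _ ↦ 1) c d a A d' ≠ 0)
    {F : Type} [AddCommGroup F] [Module (IwasawaAlgebra p) F] [Module.Finite (IwasawaAlgebra p) F]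
    [NoZeroSMulDivisors (IwasawaAlgebra p) F]
    (j : I.H →ₗ[IwasawaAlgebra p] F) (hj : Function.Injective j) (hcok : Finite (F ⧸ LinearMap.range j))
    (zF : F) (hzF : zF ≠ 0) (hFZ : Module.IsTorsion (IwasawaAlgebra p) (F ⧸ (IwasawaAlgebra p) ∙ zF))
    (hdiv : ∀ 𝔮 : PrimeSpectrum (IwasawaAlgebra p), 𝔮.asIdeal.height = 1 → 𝔮.asIdeal ≠ augIdealP p →
      Module.lengthAt (IwasawaAlgebra p) (W.fineSelmerDualData κ hγ).X 𝔮 ≤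
        Module.lengthAt (IwasawaAlgebra p) (F ⧸ (IwasawaAlgebra p) ∙ zF) 𝔮)
    (lam : IwasawaAlgebra p) (hlam : PowerSeries.constantCoeff lam ≠ 0) (hjy : j y = lam • zF)
    (e : ℕ) (hb : ZetaLineOrthIndexAt W p (layerZeroToTop W p κ (I.proj 0 y)) e) :
    padicValNat p (Nat.card (AddCommGroup.primaryComponent W.sha p)) + padicValNat p W.tamagawaProduct +
        (PowerSeries.constantCoeff lam).valuation ≤
      e + padicValNat p ((W.baseChange ((primePlace p).adicCompletion ℚ)).localTamagawaNumber
          ((primePlace p).adicCompletionIntegers ℚ)) + 2 * padicValNat p W.torsionOrder :=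
  padicValNat_sha_add_tamagawa_add_valuation_le_of_zetaLineOrthIndexAt_of_hull W p hX hLim hFW hp hκ hγ hred h4 I j hj hcok zF hzF
    hFZ hdiv y lam hlam hjy (MemberIndexOfValue.not_isOfFinAddOrder_proj_zero_of_zetaBody hκ hp hbody hκ' hf hL1 hA d' hcd hdd' hR hy)
    e hb

end ZetaLift

end Summit.BirchSwinnertonDyer.BirchSwinnertonDyer.Theorems.ReducibleHullDescentCount

end
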